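import Literature.NumberTheory.Transcendental.DiazMainIIIConstruction
import Literature.NumberTheory.Transcendental.HermiteInterpolationBound
import Literature.NumberTheory.Transcendental.DiazPoints
import Literature.NumberTheory.Transcendental.DiazZeroFree
import Literature.NumberTheory.Transcendental.DiazZeroLemmaMult
import Mathlib.Analysis.Complex.Liouville
import HarnessLib

/-!
# Laurent's Théorème 3 iii) — smallness at the perturbed point and zero-freeness on the ball

Topic `Literature/NumberTheory/Transcendental`. Second step (after `DiazMainIIIConstruction.lean`)
of the conditional proof of the large range of `Diaz1989_main_iii` (`DiazMain.lean`; M. Laurent,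
Astérisque 198–200 (1991), §3.1, Théorème 3 iii); Diaz 1989 / Philippon 1986, Thm 2.12 (i)) from
`Philippon1986_mainCriterion` and `Philippon1986_GaGm`: the two properties that Philippon's
criterion asks of the family `𝓕 = {Q_{l,t,j}}` at the points `θ'` of a small ball around
`θ = (y, x, e^{yx})`. Everything here is PROVED; the definitions are concrete functions.

Smallness (Gel'fond's extrapolation WITH multiplicities, run at the perturbed point — the step
that has no printed model: Diaz 1989, §II-3-2, is multiplicity-free):

* `ytil`, `xtil`, `coefPj`, `Ftil` — `F̃(z) = ∑ P_{aμj}(θ') z^a e^{(μ·ỹ)z}` (`= ExpGrid.Phi ỹ c`);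
  `kappa` — the twist `κ_{μ,l} = E_{μ,l}(θ') e^{-(μ·ỹ)(l·x̃)}` (`= 1` at `θ' = θ`); `Ftw` — the
  twisted functions `F̃_l(z) = ∑ P_{aμj}(θ') κ_{μ,l} z^a e^{(μ·ỹ)z}`, for which
  `Q_{l,t,j}(θ') = F̃_l^{(t)}(l·x̃)` EXACTLY (`aeval_Qj_eq_iteratedDeriv_Ftw`).
* `norm_iteratedDeriv_Ftil_pts_le` — `F̃` has small `S`-jets at the points of `𝓔(M) = {l·x̃}`:
  `F̃^{(t)} = F̃_l^{(t)} - (F̃_l - F̃)^{(t)}`, the first term is `Q_{l,t,j}(θ') = 0` by Diaz's key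
  identity at a minimal index (`aeval_Qj_eq_zero_of_isMinIdx`), the second is `O(κ)` by Cauchy
  (`norm_Ftw_sub_Ftil_le`, `Ftw_sub_Ftil`).
* `norm_aeval_Qj_le` — **the smallness of `Q_{l,t,j}(θ')` on the large box `l ≤ M₂`**, from
  `Hermite.norm_iteratedDeriv_le_of_small_jets` (`HermiteInterpolationBound.lean`) on `𝓔(M)` (point
  count, separation and product bound from `DiazPoints.lean`) plus Cauchy for the twist; the bound
  is explicit (`hermH`).
* `separated_of_near`, `kappa_eq_prod`, `norm_twistFactor_sub_one_le`, `norm_kappa_sub_one_le`,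
  `norm_pow_sub_one_le`, `norm_prod_sub_one_le`, `one_add_pow_sub_one_le` — the perturbed data on
  the ball `max|θ'_v - θ_v| ≤ ε_b`: separation of `x̃` and `|κ - 1| ≤ 3nmLM₂ c_β ε_b`.

Zero-freeness (the zero lemma with multiplicities applied, as Diaz applies his, §II-3-4):

* `zlog3`, `exp_zlog3`, `norm_zlog3_sub_le` — logarithms `z_ik` with `e^{z_ik} = θ'(w_ik)`;
  `Ptil` — `P̃ = ∑ P_{aμj}(θ') X₀^a W^μ ∈ ℂ[X₀, W]`, `≠ 0` at a minimal index (`Ptil_ne_zero`),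
  `deg_{X₀} ≤ D-1`, `deg_{W_h} ≤ L-1`; `evalAt_Ptil_eq`, `iteratedDeriv_evalAt_Ptil` — the family's
  values at `θ'` are the derivatives of `P̃` along `(1, ỹ)` at the points
  `σ(l) = exp_G(l·x̃, (∑ l_kz_ik)_i)` of `𝔾ₐ × 𝔾ₘⁿ`.
* `exists_aeval_Qj_ne_zero (hZ : Philippon1986_GaGm)` — **some `Q_{l,t,j}`, `l ≤ (n+1)B`,
  `t ≤ (n+1)T`, does not vanish at `θ'`**, as soon as the parameters satisfy the two counting
  inequalities of `DiazZLM.zeroLemmaMult_of_GaGm'` and the measures of linear independence exclude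
  its small relations.

## References

* M. Laurent, *Sur quelques résultats récents de transcendance*, Astérisque 198–200 (1991),
  §3.1, Théorème 3 iii), p. 213. [Laurent1991]
* G. Diaz, *Grands degrés de transcendance pour des familles d'exponentielles*, J. Number Theory
  31 (1989), 1–23, §II-3-2 (pp. 6–11), §II-3-4 (pp. 11–14). [Diaz1989]
* P. Philippon, *Lemmes de zéros dans les groupes algébriques commutatifs*, Bull. Soc. Math.
  France 114 (1986), Thm 2.1. [Philippon1986]
* P. Philippon, *Critères pour l'indépendance algébrique*, Publ. Math. IHÉS 64 (1986),
  Thm 2.12 (i), p. 40. [Philippon1986Criteres]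
-/

noncomputable section

open MvPolynomial Finset Finsupp Complex
open scoped Polynomial
open Literature.NumberTheory.Transcendental.ExpGrid
open Literature.NumberTheory.Transcendental.Chudnovsky (wnorm wnorm_nonneg wnorm_mul_le
  wnorm_sum_le le_wnorm l1)
open Literature.NumberTheory.Transcendental.Taylor

namespace Literature.NumberTheory.Transcendental

namespace DiazMainIII

open Metric
open Literature.NumberTheory.Transcendental.DiazThm1 (muv pts Separated card_pts norm_le_of_mem_pts
  le_norm_muv_sub_muv prod_pts_erase_ge muv_sub_muv injOn_muv)

/-! ### Products of numbers close to `1` -/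

/-- If `|β - 1| ≤ ε` (`ε ≥ 0`) then `|β^k - 1| ≤ (1+ε)^k - 1`. [folklore] -/
theorem norm_pow_sub_one_le {β : ℂ} {ε : ℝ} (hε : 0 ≤ ε) (h : ‖β - 1‖ ≤ ε) (k : ℕ) :
    ‖β ^ k - 1‖ ≤ (1 + ε) ^ k - 1 := by
  have hβ : ‖β‖ ≤ 1 + ε := by
    have := norm_le_norm_add_norm_sub' β 1
    rw [norm_one] at this
    linarith
  induction k with
  | zero => simp
  | succ k ih =>
    have e : β ^ (k + 1) - 1 = β * (β ^ k - 1) + (β - 1) := by ring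
    rw [e]
    calc ‖β * (β ^ k - 1) + (β - 1)‖ ≤ ‖β‖ * ‖β ^ k - 1‖ + ‖β - 1‖ := by
          refine (norm_add_le _ _).trans ?_
          rw [norm_mul]
      _ ≤ (1 + ε) * ((1 + ε) ^ k - 1) + ε := by
          have h1 : 0 ≤ (1 + ε) ^ k - 1 := by
            have := one_le_pow₀ (show (1 : ℝ) ≤ 1 + ε by linarith) (n := k)
            linarith
          gcongr
      _ = (1 + ε) ^ (k + 1) - 1 := by ring

/-- If `|zᵢ - 1| ≤ (1+ε)^{kᵢ} - 1` on a finite set then `|∏ zᵢ - 1| ≤ (1+ε)^{∑ kᵢ} - 1`.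
[folklore] -/
theorem norm_prod_sub_one_le {ι : Type*} (s : Finset ι) (z : ι → ℂ) (k : ι → ℕ) {ε : ℝ}
    (hε : 0 ≤ ε) (h : ∀ i ∈ s, ‖z i - 1‖ ≤ (1 + ε) ^ k i - 1) :
    ‖∏ i ∈ s, z i - 1‖ ≤ (1 + ε) ^ (∑ i ∈ s, k i) - 1 := by
  classical
  induction s using Finset.induction_on with
  | empty => simp
  | insert a s ha ih =>
    rw [Finset.prod_insert ha, Finset.sum_insert ha]
    have hz : ‖z a‖ ≤ (1 + ε) ^ k a := by
      have := norm_le_norm_add_norm_sub' (z a) 1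
      rw [norm_one] at this
      have := h a (Finset.mem_insert_self a s)
      linarith
    have hih := ih fun i hi => h i (Finset.mem_insert_of_mem hi)
    have e : z a * ∏ i ∈ s, z i - 1 = z a * (∏ i ∈ s, z i - 1) + (z a - 1) := by ring
    rw [e]
    have h1 : 0 ≤ (1 + ε) ^ (∑ i ∈ s, k i) - 1 := by
      have := one_le_pow₀ (show (1 : ℝ) ≤ 1 + ε by linarith) (n := ∑ i ∈ s, k i)
      linarith
    calc ‖z a * (∏ i ∈ s, z i - 1) + (z a - 1)‖
        ≤ ‖z a‖ * ‖∏ i ∈ s, z i - 1‖ + ‖z a - 1‖ := by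
          refine (norm_add_le _ _).trans ?_; rw [norm_mul]
      _ ≤ (1 + ε) ^ k a * ((1 + ε) ^ (∑ i ∈ s, k i) - 1) + ((1 + ε) ^ k a - 1) := by
          gcongr
          · exact h a (Finset.mem_insert_self a s)
      _ = (1 + ε) ^ (k a + ∑ i ∈ s, k i) - 1 := by rw [pow_add]; ring

/-- `(1+ε)^N - 1 ≤ 3Nε` when `0 ≤ ε` and `Nε ≤ 1`. [folklore] -/
theorem one_add_pow_sub_one_le {ε : ℝ} (hε : 0 ≤ ε) {N : ℕ} (hN : (N : ℝ) * ε ≤ 1) :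
    (1 + ε) ^ N - 1 ≤ 3 * N * ε := by
  -- `(1+ε)^N - 1 = ε ∑_{k<N} (1+ε)^k ≤ ε N (1+ε)^N ≤ ε N e ≤ 3Nε`
  have h1 : (1 : ℝ) ≤ 1 + ε := by linarith
  have hgeom : ((1 + ε) ^ N - 1) = (∑ i ∈ Finset.range N, (1 + ε) ^ i) * ε := by
    have := geom_sum_mul (1 + ε) N
    rw [show (1 + ε) - 1 = ε by ring] at this
    linarith
  have hsum : ∑ i ∈ Finset.range N, (1 + ε) ^ i ≤ N * (1 + ε) ^ N := by
    calc ∑ i ∈ Finset.range N, (1 + ε) ^ i ≤ ∑ _i ∈ Finset.range N, (1 + ε) ^ N :=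
          Finset.sum_le_sum fun i hi => pow_le_pow_right₀ h1 (Finset.mem_range.mp hi).le
      _ = N * (1 + ε) ^ N := by simp
  have hexp : (1 + ε) ^ N ≤ 3 := by
    calc (1 + ε) ^ N ≤ Real.exp ε ^ N := by
          refine pow_le_pow_left₀ (by linarith) ?_ _
          have := Real.add_one_le_exp ε
          linarith
      _ = Real.exp (N * ε) := by rw [← Real.exp_nat_mul]
      _ ≤ Real.exp 1 := Real.exp_le_exp.mpr hN
      _ ≤ 3 := by
          have := Real.exp_one_lt_d9
          linarith
  rw [hgeom]
  calc (∑ i ∈ Finset.range N, (1 + ε) ^ i) * ε ≤ (N * (1 + ε) ^ N) * ε :=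
        mul_le_mul_of_nonneg_right hsum hε
    _ ≤ (N * 3) * ε := by
        refine mul_le_mul_of_nonneg_right ?_ hε
        exact mul_le_mul_of_nonneg_left hexp (Nat.cast_nonneg N)
    _ = 3 * N * ε := by ring

/-! ### The data attached to a point `θ'` of the ball -/

variable {n m D L b : ℕ}

/-- The perturbed frequencies `ỹᵢ = θ'(yᵢ)`. [folklore] -/
def ytil (θ' : Var n m → ℂ) : Fin n → ℂ := fun i => θ' (Sum.inl i)

/-- The perturbed points `x̃_k = θ'(x_k)`. [folklore] -/
def xtil (θ' : Var n m → ℂ) : Fin m → ℂ := fun k => θ' (Sum.inr (Sum.inl k))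

/-- `W_μ(θ') = μ·ỹ`. [folklore] -/
theorem aeval_Wsym_eq (θ' : Var n m → ℂ) (μ : Fin n → ℕ) :
    aeval θ' (Wsym m μ) = wfreq (ytil θ') μ := by
  simp [Wsym, wfreq, ytil, map_sum]

/-- `Y_l(θ') = l·x̃`. [folklore] -/
theorem aeval_Ysym_eq (θ' : Var n m → ℂ) (l : Fin m → ℕ) :
    aeval θ' (Ysym n l) = muv (xtil θ') l := by
  simp [Ysym, muv, xtil, map_sum]

/-- The coefficients `c_{aμ} = P_{aμj}(θ')`. [folklore] -/
def coefPj (p : Unk n m D L b → ℤ) (θ' : Var n m → ℂ) (j : Var n m →₀ ℕ) : AM n D L → ℂ :=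
  fun am => aeval θ' (Pj p am j)

/-- **The entire function `F̃(z) = ∑ P_{aμj}(θ') z^a e^{(μ·ỹ)z}`** attached to `(θ', j)`
(`= ExpGrid.Phi ỹ c`). [cite: Diaz1989, §II-3-2 (c) p. 9 (the function F̃, here with the
perturbed frequencies)] -/
def Ftil (p : Unk n m D L b → ℤ) (θ' : Var n m → ℂ) (j : Var n m →₀ ℕ) : ℂ → ℂ :=
  Phi (ytil θ') (coefPj p θ' j)

/-- The twist `κ_{μ,l}(θ') = E_{μ,l}(θ') e^{-(μ·ỹ)(l·x̃)}` (`= 1` at the true point). [folklore] -/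
def kappa (θ' : Var n m → ℂ) (μ : Fin n → ℕ) (l : Fin m → ℕ) : ℂ :=
  aeval θ' (Esym μ l) * cexp (-(wfreq (ytil θ') μ * muv (xtil θ') l))

/-- **The twisted function `F̃_l(z) = ∑ P_{aμj}(θ') κ_{μ,l} z^a e^{(μ·ỹ)z}`**, whose derivatives at
`l·x̃` are EXACTLY the values `Q_{l,t,j}(θ')` (`aeval_Qj_eq_iteratedDeriv_Ftw`). [folklore] -/
def Ftw (p : Unk n m D L b → ℤ) (θ' : Var n m → ℂ) (j : Var n m →₀ ℕ) (l : Fin m → ℕ) : ℂ → ℂ :=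
  fun z => ∑ am : AM n D L, coefPj p θ' j am * kappa θ' (natOf am.2) l *
    (z ^ (am.1 : ℕ) * cexp (wfreq (ytil θ') (natOf am.2) * z))

/-- `F̃` written out. [folklore] -/
theorem Ftil_apply (p : Unk n m D L b → ℤ) (θ' : Var n m → ℂ) (j : Var n m →₀ ℕ) (z : ℂ) :
    Ftil p θ' j z = ∑ am : AM n D L, coefPj p θ' j am *
      (z ^ (am.1 : ℕ) * cexp (wfreq (ytil θ') (natOf am.2) * z)) := by
  unfold Ftil Phi
  rfl

/-- `F̃` is entire. [folklore] -/
theorem differentiable_Ftil (p : Unk n m D L b → ℤ) (θ' : Var n m → ℂ) (j : Var n m →₀ ℕ) :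
    Differentiable ℂ (Ftil p θ' j) :=
  differentiable_Phi _ _

/-- `F̃_l` is entire. [folklore] -/
theorem differentiable_Ftw (p : Unk n m D L b → ℤ) (θ' : Var n m → ℂ) (j : Var n m →₀ ℕ)
    (l : Fin m → ℕ) : Differentiable ℂ (Ftw p θ' j l) := by
  unfold Ftw
  refine Differentiable.fun_sum fun am _ => ?_
  refine (differentiable_const _).mul ?_
  exact (differentiable_pow _).mul (((differentiable_const _).mul differentiable_id).cexp)

/-- **`Q_{l,t,j}(θ') = F̃_l^{(t)}(l·x̃)`.** [folklore] -/
theorem aeval_Qj_eq_iteratedDeriv_Ftw (p : Unk n m D L b → ℤ) (θ' : Var n m → ℂ)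
    (j : Var n m →₀ ℕ) (l : Fin m → ℕ) (t : ℕ) :
    aeval θ' (Qj p l t j) = iteratedDeriv t (Ftw p θ' j l) (muv (xtil θ') l) := by
  rw [aeval_Qj_eq_iteratedDeriv]
  have hfun : (fun τ : ℂ => ∑ am : AM n D L,
      aeval θ' (Pj p am j) * aeval θ' (Esym (natOf am.2) l) *
        ((aeval θ' (Ysym n l) + τ) ^ (am.1 : ℕ) * cexp (aeval θ' (Wsym m (natOf am.2)) * τ))) =
      fun τ => Ftw p θ' j l (τ + muv (xtil θ') l) := by
    funext τ
    unfold Ftw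
    refine Finset.sum_congr rfl fun am _ => ?_
    rw [aeval_Ysym_eq, aeval_Wsym_eq, coefPj, kappa]
    set W := wfreq (ytil θ') (natOf am.2)
    set Y := muv (xtil θ') l
    rw [add_comm τ Y, show W * (Y + τ) = W * τ + W * Y by ring, Complex.exp_add]
    have : cexp (-(W * Y)) * cexp (W * Y) = 1 := by rw [← Complex.exp_add]; simp
    calc aeval θ' (Pj p am j) * aeval θ' (Esym (natOf am.2) l) *
          ((Y + τ) ^ (am.1 : ℕ) * cexp (W * τ))
        = aeval θ' (Pj p am j) * aeval θ' (Esym (natOf am.2) l) *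
          ((Y + τ) ^ (am.1 : ℕ) * cexp (W * τ)) * (cexp (-(W * Y)) * cexp (W * Y)) := by
          rw [this, mul_one]
      _ = _ := by ring
  rw [hfun, iteratedDeriv_comp_add_const t (Ftw p θ' j l) (muv (xtil θ') l)]
  simp

/-- The difference `F̃_l - F̃ = ∑ c_{aμ} (κ_{μ,l} - 1) z^a e^{(μ·ỹ)z}`. [folklore] -/
theorem Ftw_sub_Ftil (p : Unk n m D L b → ℤ) (θ' : Var n m → ℂ) (j : Var n m →₀ ℕ)
    (l : Fin m → ℕ) (z : ℂ) :
    Ftw p θ' j l z - Ftil p θ' j z = ∑ am : AM n D L, coefPj p θ' j am * (kappa θ' (natOf am.2) l - 1) *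
      (z ^ (am.1 : ℕ) * cexp (wfreq (ytil θ') (natOf am.2) * z)) := by
  rw [Ftil_apply, Ftw, ← Finset.sum_sub_distrib]
  refine Finset.sum_congr rfl fun am _ => ?_
  ring

/-! ### Growth of `F̃` and of `F̃_l - F̃` -/

/-- `|w_μ| ≤ L ∑|ỹᵢ|` for `μ ∈ [0,L)ⁿ`. [folklore] -/
theorem norm_wfreq_le (y' : Fin n → ℂ) {μ : Fin n → ℕ} (hμ : ∀ i, μ i < L) :
    ‖wfreq y' μ‖ ≤ L * ∑ i, ‖y' i‖ := by
  unfold wfreq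
  calc ‖∑ i, (μ i : ℂ) * y' i‖ ≤ ∑ i, ‖(μ i : ℂ) * y' i‖ := norm_sum_le _ _
    _ ≤ ∑ i, (L : ℝ) * ‖y' i‖ := Finset.sum_le_sum fun i _ => by
        rw [norm_mul, Complex.norm_natCast]
        exact mul_le_mul_of_nonneg_right (by exact_mod_cast (hμ i).le) (norm_nonneg _)
    _ = L * ∑ i, ‖y' i‖ := by rw [Finset.mul_sum]

/-- The exponential monomial bound: `|z^a e^{wz}| ≤ R^D e^{W R}` for `|z| ≤ R`, `R ≥ 1`, `a < D`,
`|w| ≤ W`. [folklore] -/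
theorem norm_pow_mul_exp_le {z w : ℂ} {R W : ℝ} {a D : ℕ} (hR : 1 ≤ R) (hz : ‖z‖ ≤ R) (ha : a < D)
    (hw : ‖w‖ ≤ W) : ‖z ^ a * cexp (w * z)‖ ≤ R ^ D * Real.exp (W * R) := by
  rw [norm_mul, norm_pow, Complex.norm_exp]
  refine mul_le_mul ?_ ?_ (by positivity) (by positivity)
  · exact (pow_le_pow_left₀ (norm_nonneg _) hz a).trans (pow_le_pow_right₀ hR ha.le)
  · refine Real.exp_le_exp.mpr ?_
    calc (w * z).re ≤ ‖w * z‖ := Complex.re_le_norm _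
      _ = ‖w‖ * ‖z‖ := norm_mul _ _
      _ ≤ W * R := mul_le_mul hw hz (norm_nonneg _) ((norm_nonneg _).trans hw)

/-- **Growth of `F̃`**: `|F̃(z)| ≤ #AM · C · R^D e^{L(∑|ỹᵢ|)R}` for `|z| ≤ R`, `R ≥ 1`, if
`|P_{aμj}(θ')| ≤ C`. [folklore] -/
theorem norm_Ftil_le (p : Unk n m D L b → ℤ) (θ' : Var n m → ℂ) (j : Var n m →₀ ℕ) {C R : ℝ}
    (hC0 : 0 ≤ C) (hC : ∀ am, ‖coefPj p θ' j am‖ ≤ C) (hR : 1 ≤ R) {z : ℂ} (hz : ‖z‖ ≤ R) :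
    ‖Ftil p θ' j z‖ ≤ Fintype.card (AM n D L) *
      (C * (R ^ D * Real.exp (L * (∑ i, ‖ytil θ' i‖) * R))) := by
  rw [Ftil_apply]
  calc ‖∑ am : AM n D L, coefPj p θ' j am *
        (z ^ (am.1 : ℕ) * cexp (wfreq (ytil θ') (natOf am.2) * z))‖
      ≤ ∑ am : AM n D L, ‖coefPj p θ' j am *
        (z ^ (am.1 : ℕ) * cexp (wfreq (ytil θ') (natOf am.2) * z))‖ := norm_sum_le _ _
    _ ≤ ∑ _am : AM n D L, C * (R ^ D * Real.exp (L * (∑ i, ‖ytil θ' i‖) * R)) := by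
        refine Finset.sum_le_sum fun am _ => ?_
        rw [norm_mul]
        refine mul_le_mul (hC am) ?_ (norm_nonneg _) hC0
        exact norm_pow_mul_exp_le hR hz am.1.isLt (norm_wfreq_le (ytil θ') (natOf_lt am.2))
    _ = _ := by rw [Finset.sum_const, Finset.card_univ, nsmul_eq_mul]

/-- **Growth of `F̃_l - F̃`**: `|(F̃_l - F̃)(z)| ≤ #AM · C · κ · R^D e^{L(∑|ỹᵢ|)R}` for `|z| ≤ R`,
`R ≥ 1`, if `|P_{aμj}(θ')| ≤ C` and `|κ_{μ,l} - 1| ≤ κ` for `μ ∈ [0,L)ⁿ`. [folklore] -/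
theorem norm_Ftw_sub_Ftil_le (p : Unk n m D L b → ℤ) (θ' : Var n m → ℂ) (j : Var n m →₀ ℕ)
    (l : Fin m → ℕ) {C κ R : ℝ} (hC0 : 0 ≤ C) (hC : ∀ am, ‖coefPj p θ' j am‖ ≤ C) (hκ0 : 0 ≤ κ)
    (hκ : ∀ μ : Fin n → ℕ, (∀ i, μ i < L) → ‖kappa θ' μ l - 1‖ ≤ κ) (hR : 1 ≤ R) {z : ℂ}
    (hz : ‖z‖ ≤ R) :
    ‖Ftw p θ' j l z - Ftil p θ' j z‖ ≤ Fintype.card (AM n D L) *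
      (C * κ * (R ^ D * Real.exp (L * (∑ i, ‖ytil θ' i‖) * R))) := by
  rw [Ftw_sub_Ftil]
  calc ‖∑ am : AM n D L, coefPj p θ' j am * (kappa θ' (natOf am.2) l - 1) *
        (z ^ (am.1 : ℕ) * cexp (wfreq (ytil θ') (natOf am.2) * z))‖
      ≤ ∑ am : AM n D L, ‖coefPj p θ' j am * (kappa θ' (natOf am.2) l - 1) *
        (z ^ (am.1 : ℕ) * cexp (wfreq (ytil θ') (natOf am.2) * z))‖ := norm_sum_le _ _
    _ ≤ ∑ _am : AM n D L, C * κ * (R ^ D * Real.exp (L * (∑ i, ‖ytil θ' i‖) * R)) := by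
        refine Finset.sum_le_sum fun am _ => ?_
        rw [norm_mul, norm_mul]
        refine mul_le_mul (mul_le_mul (hC am) (hκ _ (natOf_lt am.2)) (norm_nonneg _) hC0) ?_
          (norm_nonneg _) (mul_nonneg hC0 hκ0)
        exact norm_pow_mul_exp_le hR hz am.1.isLt (norm_wfreq_le (ytil θ') (natOf_lt am.2))
    _ = _ := by rw [Finset.sum_const, Finset.card_univ, nsmul_eq_mul]

/-! ### Small jets of `F̃` at the points of Siegel's box -/

/-- **Approximate zeros of `F̃`.** If `Q_{l,t} = 0` for `l ∈ [0,M)^m`, `t < S`, and `j` is a minimal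
index at `θ'`, then at every point `e = l·x̃` of `𝓔(M) = pts x̃ M` and every `t < S`,
`|F̃^{(t)}(e)| ≤ t! · #AM · C · κ · (r+1)^D e^{L(∑|ỹᵢ|)(r+1)}`, where `|e| ≤ r` (`r ≥ 0`),
`|P_{aμj}(θ')| ≤ C` and `|κ_{μ,l} - 1| ≤ κ` on `[0,L)ⁿ × [0,M)^m`: indeed
`F̃^{(t)}(e) = F̃_l^{(t)}(e) - (F̃_l - F̃)^{(t)}(e)`, the first term is `Q_{l,t,j}(θ') = 0`
(`aeval_Qj_eq_zero_of_isMinIdx`) and the second is estimated by Cauchy on `|z - e| = 1`.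
[cite: Diaz1989, §II-3-2 (b) p. 9 (the smallness of F̃ at the points μ.v)] -/
theorem norm_iteratedDeriv_Ftil_pts_le (p : Unk n m D L b → ℤ) (θ' : Var n m → ℂ)
    (j : Var n m →₀ ℕ) {M S : ℕ} (hQ : ∀ l : Fin m → ℕ, (∀ k, l k < M) → ∀ t < S, Q p l t = 0)
    (hj : IsMinIdx p θ' j) {C κ r : ℝ} (hC0 : 0 ≤ C) (hC : ∀ am, ‖coefPj p θ' j am‖ ≤ C)
    (hκ0 : 0 ≤ κ)
    (hκ : ∀ μ : Fin n → ℕ, (∀ i, μ i < L) → ∀ l : Fin m → ℕ, (∀ k, l k < M) → ‖kappa θ' μ l - 1‖ ≤ κ)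
    (hr : 0 ≤ r) (hrpts : ∀ e ∈ pts (xtil θ') M, ‖e‖ ≤ r)
    {e : ℂ} (he : e ∈ pts (xtil θ') M) {t : ℕ} (ht : t < S) :
    ‖iteratedDeriv t (Ftil p θ' j) e‖ ≤ t.factorial * (Fintype.card (AM n D L) *
      (C * κ * ((r + 1) ^ D * Real.exp (L * (∑ i, ‖ytil θ' i‖) * (r + 1))))) := by
  classical
  obtain ⟨l, hl, rfl⟩ := Finset.mem_image.mp he
  have hl' : ∀ k, l k < M := Behrend.mem_box.mp hl
  -- `F̃ = F̃_l - (F̃_l - F̃)` and the first term has vanishing `t`-th derivative at `l·x̃`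
  have hzero : iteratedDeriv t (Ftw p θ' j l) (muv (xtil θ') l) = 0 := by
    rw [← aeval_Qj_eq_iteratedDeriv_Ftw]
    exact aeval_Qj_eq_zero_of_isMinIdx (hQ l hl' t ht) hj
  have hdiff : Differentiable ℂ (fun z => Ftw p θ' j l z - Ftil p θ' j z) :=
    (differentiable_Ftw p θ' j l).sub (differentiable_Ftil p θ' j)
  have hsplit : iteratedDeriv t (Ftil p θ' j) (muv (xtil θ') l) =
      iteratedDeriv t (Ftw p θ' j l) (muv (xtil θ') l) -
        iteratedDeriv t (fun z => Ftw p θ' j l z - Ftil p θ' j z) (muv (xtil θ') l) := by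
    rw [iteratedDeriv_fun_sub ((differentiable_Ftw p θ' j l).contDiff.contDiffAt)
      ((differentiable_Ftil p θ' j).contDiff.contDiffAt)]
    ring
  rw [hsplit, hzero, zero_sub, norm_neg]
  -- Cauchy's estimate on the circle of radius `1` around `e`
  have hCau : ∀ z ∈ sphere (muv (xtil θ') l) 1, ‖Ftw p θ' j l z - Ftil p θ' j z‖ ≤
      Fintype.card (AM n D L) * (C * κ * ((r + 1) ^ D * Real.exp (L * (∑ i, ‖ytil θ' i‖) * (r + 1)))) := by
    intro z hz
    have hz1 : ‖z‖ ≤ r + 1 := by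
      have h1 : ‖z - muv (xtil θ') l‖ = 1 := by
        have : dist z (muv (xtil θ') l) = 1 := hz
        rwa [dist_eq_norm] at this
      have := norm_le_norm_add_norm_sub' z (muv (xtil θ') l)
      have := hrpts _ he
      linarith
    exact norm_Ftw_sub_Ftil_le p θ' j l hC0 hC hκ0 (fun μ hμ => hκ μ hμ l hl') (by linarith) hz1
  have := Complex.norm_iteratedDeriv_le_of_forall_mem_sphere_norm_le t zero_lt_one hdiff.diffContOnCl hCau
  simpa using this

/-! ### Extrapolation: smallness of `Q_{l,t,j}(θ')` on the large box -/

/-- `|l·x̃| ≤ M₂ ∑|x̃_k|` for `l ≤ M₂` componentwise. [folklore] -/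
theorem norm_muv_le (x' : Fin m → ℂ) {M₂ : ℕ} {l : Fin m → ℕ} (hl : ∀ k, l k ≤ M₂) :
    ‖muv x' l‖ ≤ M₂ * ∑ k, ‖x' k‖ := by
  unfold muv
  calc ‖∑ k, (l k : ℂ) * x' k‖ ≤ ∑ k, ‖(l k : ℂ) * x' k‖ := norm_sum_le _ _
    _ ≤ ∑ k, (M₂ : ℝ) * ‖x' k‖ := Finset.sum_le_sum fun k _ => by
        rw [norm_mul, Complex.norm_natCast]
        exact mul_le_mul_of_nonneg_right (by exact_mod_cast hl k) (norm_nonneg _)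
    _ = M₂ * ∑ k, ‖x' k‖ := by rw [Finset.mul_sum]

/-- The Hermite bound `𝓗(t) = N S ε (2(t+r))^{SN} (2/δ)^S / Λ₀^S` of
`HermiteInterpolationBound.lean`, as a function of its parameters. [folklore] -/
def hermH (N S : ℕ) (ε r δ Λ₀ t : ℝ) : ℝ :=
  N * S * ε * (2 * (t + r)) ^ (S * N) * (2 / δ) ^ S / Λ₀ ^ S

/-- **Smallness of `Q_{l,t,j}(θ')` on the large box `l ≤ M₂`** (Gel'fond's extrapolation with
multiplicities, at the perturbed point). Data: `Q_{l,t} = 0` for `l ∈ [0,M)^m`, `t < S`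
(Siegel); `j` minimal at `θ'`; `|P_{aμj}(θ')| ≤ C`; `|κ_{μ,l}(θ') - 1| ≤ κ` for `μ ∈ [0,L)ⁿ`,
`l ≤ M₂` (`2 ≤ M ≤ M₂`); the perturbed points `x̃` are `δ`-separated at scale `M` (`0 < δ ≤ 1`).
With `X̃ = ∑|x̃_k|`, `Ỹ = ∑|ỹᵢ|`, `r = MX̃ + 1`, `ρ₁ = M₂X̃`, `N = M^m`,
`Λ₀ = (δ min(1,|x̃_m|/2)^M)^{M^{m-1}}`, `ε = S!·#AM·Cκ r^D e^{LỸr}`, `B = #AM·C·R^D e^{LỸR}`,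
`R ≥ ρ₁ + 1`, `R > r`, one has for `l ≤ M₂` and every `t`:
`|Q_{l,t,j}(θ')| ≤ t!·[𝓗(ρ₁+1) + (B + 𝓗(R))·((ρ₁+1+r)/(R-r))^{SN}] + t!·#AM·Cκ(ρ₁+1)^D e^{LỸ(ρ₁+1)}`
(`𝓗 = hermH N S ε r δ Λ₀`): `Q_{l,t,j}(θ') = F̃_l^{(t)}(l·x̃)` (`aeval_Qj_eq_iteratedDeriv_Ftw`),
`F̃` has `ε`-small `S`-jets on `𝓔(M)` (`norm_iteratedDeriv_Ftil_pts_le`), so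
`Hermite.norm_iteratedDeriv_le_of_small_jets` bounds `F̃^{(t)}` on `|w| ≤ ρ₁`, and
`|(F̃_l - F̃)^{(t)}(l·x̃)|` is estimated by Cauchy. (The real quantities are passed with their
defining equations.)
[cite: Diaz1989, §II-3-2 (c), (d) pp. 9–11 (extrapolation from 𝓔(M) to 𝓔(M₁), here with multiplicities)] -/
theorem norm_aeval_Qj_le {m' : ℕ} (p : Unk n (m' + 1) D L b → ℤ) (θ' : Var n (m' + 1) → ℂ)
    (j : Var n (m' + 1) →₀ ℕ) {M M₂ S : ℕ} (hM2 : 2 ≤ M) (hMM : M ≤ M₂)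
    (hQ : ∀ l : Fin (m' + 1) → ℕ, (∀ k, l k < M) → ∀ t < S, Q p l t = 0)
    (hj : IsMinIdx p θ' j) {C κ δ R : ℝ} (hC0 : 0 ≤ C) (hC : ∀ am, ‖coefPj p θ' j am‖ ≤ C)
    (hκ0 : 0 ≤ κ)
    (hκ : ∀ μ : Fin n → ℕ, (∀ i, μ i < L) → ∀ l : Fin (m' + 1) → ℕ, (∀ k, l k ≤ M₂) →
      ‖kappa θ' μ l - 1‖ ≤ κ)
    (hδ : 0 < δ) (hδ1 : δ ≤ 1) (hsep : Separated (xtil θ') M δ)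
    {Xs Ys : ℝ} (hXs : Xs = ∑ k, ‖xtil θ' k‖) (hYs : Ys = ∑ i, ‖ytil θ' i‖)
    {r ρ₁ Λ₀ εj B : ℝ} (hr : r = M * Xs + 1) (hρ₁ : ρ₁ = M₂ * Xs)
    (hΛ₀ : Λ₀ = (δ * (min 1 (‖xtil θ' (Fin.last m')‖ / 2)) ^ M) ^ (M ^ m'))
    (hεj : εj = S.factorial * (Fintype.card (AM n D L) * (C * κ * (r ^ D * Real.exp (L * Ys * r)))))
    (hB : B = Fintype.card (AM n D L) * (C * (R ^ D * Real.exp (L * Ys * R))))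
    (hR1 : ρ₁ + 1 ≤ R) (hR2 : r < R)
    {l : Fin (m' + 1) → ℕ} (hl : ∀ k, l k ≤ M₂) (t : ℕ) :
    ‖aeval θ' (Qj p l t j)‖ ≤
      t.factorial * (hermH (M ^ (m' + 1)) S εj r δ Λ₀ (ρ₁ + 1) +
          (B + hermH (M ^ (m' + 1)) S εj r δ Λ₀ R) * ((ρ₁ + 1 + r) / (R - r)) ^ (S * M ^ (m' + 1))) +
      t.factorial * (Fintype.card (AM n D L) * (C * κ *
        ((ρ₁ + 1) ^ D * Real.exp (L * Ys * (ρ₁ + 1))))) := by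
  classical
  set E : Finset ℂ := pts (xtil θ') M with hE
  have hXs0 : 0 ≤ Xs := by rw [hXs]; exact Finset.sum_nonneg fun _ _ => norm_nonneg _
  have hYs0 : 0 ≤ Ys := by rw [hYs]; exact Finset.sum_nonneg fun _ _ => norm_nonneg _
  have hMXs : 0 ≤ (M : ℝ) * Xs := by positivity
  have hr1 : 1 ≤ r := by rw [hr]; linarith
  have hρ₁0 : 0 ≤ ρ₁ := by rw [hρ₁]; positivity
  have hcard0 : (0 : ℝ) ≤ Fintype.card (AM n D L) := Nat.cast_nonneg _
  -- the point set `E = 𝓔(M)`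
  have hcardE : E.card = M ^ (m' + 1) := card_pts hsep hδ
  have hEr' : ∀ e ∈ E, ‖e‖ ≤ M * Xs := fun e he => by
    rw [hXs]; exact norm_le_of_mem_pts (xtil θ') he
  have hEr : ∀ e ∈ E, ‖e‖ ≤ r := fun e he => (hEr' e he).trans (by rw [hr]; linarith)
  have hEsep : ∀ e₁ ∈ E, ∀ e₂ ∈ E, e₁ ≠ e₂ → δ ≤ ‖e₁ - e₂‖ := by
    intro e₁ he₁ e₂ he₂ hne
    obtain ⟨μ₁, hμ₁, rfl⟩ := Finset.mem_image.mp he₁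
    obtain ⟨μ₂, hμ₂, rfl⟩ := Finset.mem_image.mp he₂
    exact le_norm_muv_sub_muv hsep hμ₁ hμ₂ fun h => hne (by rw [h])
  have hω : 0 < min 1 (‖xtil θ' (Fin.last m')‖ / 2) := by
    have := Literature.NumberTheory.Transcendental.DiazThm1.le_norm_last_of_separated hsep hM2
    exact lt_min one_pos (by linarith)
  have hΛ₀pos : 0 < Λ₀ := by rw [hΛ₀]; positivity
  have hprodE : ∀ e ∈ E, Λ₀ ≤ ∏ e' ∈ E.erase e, ‖e - e'‖ := fun e he => by
    rw [hΛ₀]; exact prod_pts_erase_ge (xtil θ') hsep hδ hδ1 he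
  -- small jets on `E`
  have hεj0 : 0 ≤ εj := by rw [hεj]; positivity
  have hsmall : ∀ e ∈ E, ∀ σ < S, ‖iteratedDeriv σ (Ftil p θ' j) e‖ ≤ εj := by
    intro e he σ hσ
    have hκ' : ∀ μ : Fin n → ℕ, (∀ i, μ i < L) → ∀ l' : Fin (m' + 1) → ℕ, (∀ k, l' k < M) →
        ‖kappa θ' μ l' - 1‖ ≤ κ := fun μ hμ l' hl' => hκ μ hμ l' fun k => by
      have := hl' k; omega
    have h1 := norm_iteratedDeriv_Ftil_pts_le p θ' j hQ hj hC0 hC hκ0 hκ' hMXs hEr' he hσ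
    refine h1.trans ?_
    rw [hεj, hr, hYs]
    have hfac : (σ.factorial : ℝ) ≤ S.factorial := by exact_mod_cast Nat.factorial_le hσ.le
    have hrest : 0 ≤ (Fintype.card (AM n D L) : ℝ) * (C * κ * (((M : ℝ) * Xs + 1) ^ D *
        Real.exp (L * (∑ i, ‖ytil θ' i‖) * ((M : ℝ) * Xs + 1)))) := by positivity
    exact mul_le_mul_of_nonneg_right hfac hrest
  -- growth on `|z| = R`
  have hR1' : 1 ≤ R := by linarith
  have hBnd : ∀ z ∈ sphere (0 : ℂ) R, ‖Ftil p θ' j z‖ ≤ B := by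
    intro z hz
    have hzR : ‖z‖ ≤ R := by
      have : ‖z‖ = R := by simpa using hz
      exact this.le
    rw [hB, hYs]
    exact norm_Ftil_le p θ' j hC0 hC hR1' hzR
  -- the point `w = l·x̃`
  have hw : ‖muv (xtil θ') l‖ ≤ ρ₁ := by rw [hρ₁, hXs]; exact norm_muv_le (xtil θ') hl
  -- Hermite
  have hH := Hermite.norm_iteratedDeriv_le_of_small_jets (differentiable_Ftil p θ' j) E S hr1 hρ₁0
    hR1 hR2 hδ hδ1 hΛ₀pos hεj0 hEr hEsep hprodE hsmall hBnd hw t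
  rw [hcardE] at hH
  -- the twisted difference at `w`, by Cauchy on `|z - w| = 1`
  have hdiff : Differentiable ℂ (fun z => Ftw p θ' j l z - Ftil p θ' j z) :=
    (differentiable_Ftw p θ' j l).sub (differentiable_Ftil p θ' j)
  have hCau : ∀ z ∈ sphere (muv (xtil θ') l) 1, ‖Ftw p θ' j l z - Ftil p θ' j z‖ ≤
      Fintype.card (AM n D L) * (C * κ * ((ρ₁ + 1) ^ D * Real.exp (L * Ys * (ρ₁ + 1)))) := by
    intro z hz
    have hz1 : ‖z‖ ≤ ρ₁ + 1 := by
      have h1 : ‖z - muv (xtil θ') l‖ = 1 := by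
        have : dist z (muv (xtil θ') l) = 1 := hz
        rwa [dist_eq_norm] at this
      have := norm_le_norm_add_norm_sub' z (muv (xtil θ') l)
      linarith
    rw [hYs]
    exact norm_Ftw_sub_Ftil_le p θ' j l hC0 hC hκ0 (fun μ hμ => hκ μ hμ l hl) (by linarith) hz1
  have hD2 := Complex.norm_iteratedDeriv_le_of_forall_mem_sphere_norm_le t zero_lt_one
    hdiff.diffContOnCl hCau
  simp only [one_pow, div_one] at hD2
  -- assemble
  rw [aeval_Qj_eq_iteratedDeriv_Ftw]
  have hsplit : iteratedDeriv t (Ftw p θ' j l) (muv (xtil θ') l) =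
      iteratedDeriv t (Ftil p θ' j) (muv (xtil θ') l) +
        iteratedDeriv t (fun z => Ftw p θ' j l z - Ftil p θ' j z) (muv (xtil θ') l) := by
    rw [iteratedDeriv_fun_sub ((differentiable_Ftw p θ' j l).contDiff.contDiffAt)
      ((differentiable_Ftil p θ' j).contDiff.contDiffAt)]
    ring
  rw [hsplit]
  refine (norm_add_le _ _).trans (add_le_add ?_ hD2)
  -- match the Hermite bound with `hermH`
  refine hH.trans (le_of_eq ?_)
  simp only [hermH]


/-! ### The perturbed data: separation and the twist `κ` on the ball `max|θ'ᵥ - θᵥ| ≤ ε_b` -/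

/-- **Separation survives the perturbation**: if `x` is `δ₀`-separated at scale `M` and
`max_k |x̃_k - x_k| ≤ ε_b` with `mMε_b ≤ δ₀/2`, then `x̃` is `δ₀/2`-separated at scale `M`.
[folklore] -/
theorem separated_of_near {x x' : Fin m → ℂ} {M : ℕ} {δ₀ εb : ℝ} (hsep : Separated x M δ₀)
    (hx' : ∀ k, ‖x' k - x k‖ ≤ εb) (hεb : (m : ℝ) * M * εb ≤ δ₀ / 2) :
    Separated x' M (δ₀ / 2) := by
  intro ν hν hνM
  have h1 := hsep ν hν hνM
  have hεb0 : 0 ≤ εb := (norm_nonneg _).trans (hx' ⟨0, by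
    rcases Nat.eq_zero_or_pos m with h0 | h0
    · subst h0; exact absurd (funext fun k => Fin.elim0 k : ν = 0) hν
    · exact h0⟩)
  have hdiff : ‖∑ k, (ν k : ℂ) * x' k - ∑ k, (ν k : ℂ) * x k‖ ≤ (m : ℝ) * M * εb := by
    rw [← Finset.sum_sub_distrib]
    calc ‖∑ k, ((ν k : ℂ) * x' k - (ν k : ℂ) * x k)‖ ≤ ∑ k, ‖(ν k : ℂ) * x' k - (ν k : ℂ) * x k‖ :=
          norm_sum_le _ _
      _ ≤ ∑ _k : Fin m, (M : ℝ) * εb := Finset.sum_le_sum fun k _ => by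
          rw [← mul_sub, norm_mul]
          refine mul_le_mul ?_ (hx' k) (norm_nonneg _) (Nat.cast_nonneg _)
          have : ‖(ν k : ℂ)‖ = (|ν k| : ℝ) := by simp [Complex.norm_intCast]
          rw [this]
          exact_mod_cast (hνM k).le
      _ = (m : ℝ) * M * εb := by simp; ring
  have := norm_sub_norm_le (∑ k, (ν k : ℂ) * x k) (∑ k, (ν k : ℂ) * x' k)
  rw [norm_sub_rev] at hdiff
  linarith

/-- The twist as a product of powers:
`κ_{μ,l}(θ') = ∏ᵢ ∏_k (θ'(w_{ik}) e^{-ỹᵢx̃_k})^{μᵢ l_k}`. [folklore] -/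
theorem kappa_eq_prod (θ' : Var n m → ℂ) (μ : Fin n → ℕ) (l : Fin m → ℕ) :
    kappa θ' μ l = ∏ i, ∏ k, (θ' (Sum.inr (Sum.inr (i, k))) *
      cexp (-(ytil θ' i * xtil θ' k))) ^ (μ i * l k) := by
  unfold kappa
  have hE : aeval θ' (Esym (p := n) (q := m) μ l) =
      ∏ i, ∏ k, θ' (Sum.inr (Sum.inr (i, k))) ^ (μ i * l k) := by
    simp [Esym, map_prod]
  have hexp : cexp (-(wfreq (ytil θ') μ * muv (xtil θ') l)) =
      ∏ i, ∏ k, cexp (-(ytil θ' i * xtil θ' k)) ^ (μ i * l k) := by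
    rw [wfreq, muv, Finset.sum_mul_sum, ← Finset.sum_neg_distrib, Complex.exp_sum]
    refine Finset.prod_congr rfl fun i _ => ?_
    rw [← Finset.sum_neg_distrib, Complex.exp_sum]
    refine Finset.prod_congr rfl fun k _ => ?_
    rw [← Complex.exp_nat_mul]
    congr 1
    push_cast
    ring
  rw [hE, hexp, ← Finset.prod_mul_distrib]
  refine Finset.prod_congr rfl fun i _ => ?_
  rw [← Finset.prod_mul_distrib]
  refine Finset.prod_congr rfl fun k _ => ?_
  rw [mul_pow]

/-- **One factor of the twist is close to `1`**: if `|θ'(w_{ik}) - e^{yᵢx_k}| ≤ ε_b`,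
`|ỹᵢ - yᵢ| ≤ ε_b`, `|x̃_k - x_k| ≤ ε_b`, `ε_b ≤ 1`, `|x_k|, |yᵢ| ≤ A` (`A ≥ 1`) and
`(2A+1)ε_b ≤ 1`, then `|θ'(w_{ik}) e^{-ỹᵢx̃_k} - 1| ≤ (2(2A+1) + e^{A²+1}) ε_b`. [folklore] -/
theorem norm_twistFactor_sub_one_le {w yv xv y' x' : ℂ} {A εb : ℝ} (hA : 1 ≤ A) (hεb0 : 0 ≤ εb)
    (hεb1 : εb ≤ 1) (hy : ‖yv‖ ≤ A) (hx : ‖xv‖ ≤ A) (hw : ‖w - cexp (yv * xv)‖ ≤ εb)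
    (hy' : ‖y' - yv‖ ≤ εb) (hx' : ‖x' - xv‖ ≤ εb) (hsmall : (2 * A + 1) * εb ≤ 1) :
    ‖w * cexp (-(y' * x')) - 1‖ ≤ (2 * (2 * A + 1) + Real.exp (A ^ 2 + 1)) * εb := by
  -- `d₂ = y'x' - yx`, `|d₂| ≤ (2A+1)ε_b ≤ 1`
  set d₂ : ℂ := y' * x' - yv * xv with hd₂
  have hd₂n : ‖d₂‖ ≤ (2 * A + 1) * εb := by
    have e : d₂ = (y' - yv) * xv + y' * (x' - xv) := by rw [hd₂]; ring
    have hy'n : ‖y'‖ ≤ A + 1 := by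
      have := norm_le_norm_add_norm_sub' y' yv
      linarith [norm_sub_rev y' yv]
    rw [e]
    calc ‖(y' - yv) * xv + y' * (x' - xv)‖ ≤ ‖y' - yv‖ * ‖xv‖ + ‖y'‖ * ‖x' - xv‖ := by
          refine (norm_add_le _ _).trans ?_; rw [norm_mul, norm_mul]
      _ ≤ εb * A + (A + 1) * εb := by gcongr
      _ = (2 * A + 1) * εb := by ring
  have hd₂1 : ‖d₂‖ ≤ 1 := hd₂n.trans hsmall
  -- `w e^{-y'x'} - 1 = (e^{-d₂} - 1) + (w - e^{yx}) e^{-y'x'}`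
  have e1 : w * cexp (-(y' * x')) - 1 =
      (cexp (-d₂) - 1) + (w - cexp (yv * xv)) * cexp (-(y' * x')) := by
    have : cexp (-d₂) = cexp (yv * xv) * cexp (-(y' * x')) := by
      rw [← Complex.exp_add]; congr 1; rw [hd₂]; ring
    rw [this]; ring
  rw [e1]
  have hA0 : 0 ≤ A := zero_le_one.trans hA
  calc ‖(cexp (-d₂) - 1) + (w - cexp (yv * xv)) * cexp (-(y' * x'))‖
      ≤ ‖cexp (-d₂) - 1‖ + ‖w - cexp (yv * xv)‖ * ‖cexp (-(y' * x'))‖ := by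
        refine (norm_add_le _ _).trans ?_; rw [norm_mul]
    _ ≤ 2 * ‖-d₂‖ + εb * Real.exp (A ^ 2 + 1) := by
        refine add_le_add (Complex.norm_exp_sub_one_le (by rwa [norm_neg])) ?_
        refine mul_le_mul hw ?_ (norm_nonneg _) hεb0
        rw [Complex.norm_exp]
        refine Real.exp_le_exp.mpr ?_
        calc (-(y' * x')).re ≤ ‖-(y' * x')‖ := Complex.re_le_norm _
          _ = ‖yv * xv + d₂‖ := by rw [norm_neg, hd₂]; ring_nf
          _ ≤ ‖yv‖ * ‖xv‖ + ‖d₂‖ := by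
              refine (norm_add_le _ _).trans ?_; rw [norm_mul]
          _ ≤ A * A + 1 := add_le_add (mul_le_mul hy hx (norm_nonneg _) hA0) hd₂1
          _ = A ^ 2 + 1 := by ring
    _ ≤ 2 * ((2 * A + 1) * εb) + εb * Real.exp (A ^ 2 + 1) := by
        rw [norm_neg]; gcongr
    _ = (2 * (2 * A + 1) + Real.exp (A ^ 2 + 1)) * εb := by ring

/-- **The twist on the ball**: under the hypotheses of `norm_twistFactor_sub_one_le` for all
`i, k`, and for `μ ∈ [0,L)ⁿ`, `l ≤ M₂`: if `nmLM₂ · c_β ε_b ≤ 1` (`c_β = 2(2A+1) + e^{A²+1}`) then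
`|κ_{μ,l}(θ') - 1| ≤ 3 nmLM₂ · c_β ε_b`. [folklore] -/
theorem norm_kappa_sub_one_le (θ' : Var n m → ℂ) (y : Fin n → ℂ) (x : Fin m → ℂ) {A εb : ℝ}
    (hA : 1 ≤ A) (hεb0 : 0 ≤ εb) (hεb1 : εb ≤ 1) (hy : ∀ i, ‖y i‖ ≤ A) (hx : ∀ k, ‖x k‖ ≤ A)
    (hw : ∀ i k, ‖θ' (Sum.inr (Sum.inr (i, k))) - cexp (y i * x k)‖ ≤ εb)
    (hy' : ∀ i, ‖ytil θ' i - y i‖ ≤ εb) (hx' : ∀ k, ‖xtil θ' k - x k‖ ≤ εb)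
    (hsmall : (2 * A + 1) * εb ≤ 1) {L M₂ : ℕ}
    (hsmall2 : (n : ℝ) * m * L * M₂ * ((2 * (2 * A + 1) + Real.exp (A ^ 2 + 1)) * εb) ≤ 1)
    {μ : Fin n → ℕ} (hμ : ∀ i, μ i < L) {l : Fin m → ℕ} (hl : ∀ k, l k ≤ M₂) :
    ‖kappa θ' μ l - 1‖ ≤
      3 * ((n : ℝ) * m * L * M₂) * ((2 * (2 * A + 1) + Real.exp (A ^ 2 + 1)) * εb) := by
  set ε₁ : ℝ := (2 * (2 * A + 1) + Real.exp (A ^ 2 + 1)) * εb with hε₁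
  have hε₁0 : 0 ≤ ε₁ := by rw [hε₁]; positivity
  rw [kappa_eq_prod]
  -- each factor
  have hfac : ∀ i k, ‖(θ' (Sum.inr (Sum.inr (i, k))) * cexp (-(ytil θ' i * xtil θ' k))) ^ (μ i * l k) - 1‖ ≤
      (1 + ε₁) ^ (μ i * l k) - 1 := fun i k =>
    norm_pow_sub_one_le hε₁0 (norm_twistFactor_sub_one_le hA hεb0 hεb1 (hy i) (hx k) (hw i k)
      (hy' i) (hx' k) hsmall) _
  have h1 : ‖∏ i, ∏ k, (θ' (Sum.inr (Sum.inr (i, k))) * cexp (-(ytil θ' i * xtil θ' k))) ^ (μ i * l k) - 1‖ ≤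
      (1 + ε₁) ^ (∑ i, ∑ k, μ i * l k) - 1 := by
    refine norm_prod_sub_one_le _ _ (fun i => ∑ k, μ i * l k) hε₁0 fun i _ => ?_
    exact norm_prod_sub_one_le _ _ (fun k => μ i * l k) hε₁0 fun k _ => hfac i k
  have hN : ((∑ i, ∑ k, μ i * l k : ℕ) : ℝ) ≤ (n : ℝ) * m * L * M₂ := by
    have : ∑ i, ∑ k, μ i * l k ≤ n * m * L * M₂ := by
      calc ∑ i, ∑ k, μ i * l k ≤ ∑ _i : Fin n, ∑ _k : Fin m, L * M₂ :=
            Finset.sum_le_sum fun i _ => Finset.sum_le_sum fun k _ =>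
              Nat.mul_le_mul (hμ i).le (hl k)
        _ = n * m * L * M₂ := by simp [mul_comm, mul_left_comm]
    exact_mod_cast this
  have hNε : ((∑ i, ∑ k, μ i * l k : ℕ) : ℝ) * ε₁ ≤ 1 :=
    (mul_le_mul_of_nonneg_right hN hε₁0).trans hsmall2
  refine h1.trans ((one_add_pow_sub_one_le hε₁0 hNε).trans ?_)
  have : (3 : ℝ) * (∑ i, ∑ k, μ i * l k : ℕ) * ε₁ ≤ 3 * ((n : ℝ) * m * L * M₂) * ε₁ := by
    gcongr
  exact this


/-! ### Zero-freeness on the ball: the zero lemma with multiplicities applied -/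

section ZeroFree

open Literature.NumberTheory.Transcendental.DiazThm1 (expW expW_injective expW_zero expW_succ)
open GaGm DiazZL DiazZLM

/-- `z_ik = yᵢx_k + log(θ'(w_{ik}) e^{-yᵢx_k})` (principal logarithm), so that `e^{z_ik} = θ'(w_ik)`.
[cite: Diaz1989, §II-3-4 p. 12 (un argument de continuité)] -/
def zlog3 (y : Fin n → ℂ) (x : Fin m → ℂ) (θ' : Var n m → ℂ) (i : Fin n) (k : Fin m) : ℂ :=
  y i * x k + Complex.log (θ' (Sum.inr (Sum.inr (i, k))) * cexp (-(y i * x k)))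

/-- `e^{z_ik} = θ'(w_ik)` as soon as `θ'(w_ik) ≠ 0`. [folklore] -/
theorem exp_zlog3 (y : Fin n → ℂ) (x : Fin m → ℂ) {θ' : Var n m → ℂ} (i : Fin n) (k : Fin m)
    (hne : θ' (Sum.inr (Sum.inr (i, k))) ≠ 0) :
    cexp (zlog3 y x θ' i k) = θ' (Sum.inr (Sum.inr (i, k))) := by
  unfold zlog3
  rw [Complex.exp_add, Complex.exp_log (mul_ne_zero hne (Complex.exp_ne_zero _)), mul_left_comm,
    ← Complex.exp_add, add_neg_cancel, Complex.exp_zero, mul_one]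

/-- `|z_ik - yᵢx_k| ≤ (3/2)|θ'(w_ik) - e^{yᵢx_k}|·|e^{-yᵢx_k}|` when that product is `≤ 1/2`.
[folklore] -/
theorem norm_zlog3_sub_le (y : Fin n → ℂ) (x : Fin m → ℂ) {θ' : Var n m → ℂ} (i : Fin n) (k : Fin m)
    (hsmall : ‖θ' (Sum.inr (Sum.inr (i, k))) - cexp (y i * x k)‖ * ‖cexp (-(y i * x k))‖ ≤ 1 / 2) :
    ‖zlog3 y x θ' i k - y i * x k‖ ≤
      3 / 2 * (‖θ' (Sum.inr (Sum.inr (i, k))) - cexp (y i * x k)‖ * ‖cexp (-(y i * x k))‖) := by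
  set w : ℂ := θ' (Sum.inr (Sum.inr (i, k))) * cexp (-(y i * x k)) - 1 with hw
  have hw' : w = (θ' (Sum.inr (Sum.inr (i, k))) - cexp (y i * x k)) * cexp (-(y i * x k)) := by
    rw [hw, sub_mul, ← Complex.exp_add, add_neg_cancel, Complex.exp_zero]
  have hnw : ‖w‖ = ‖θ' (Sum.inr (Sum.inr (i, k))) - cexp (y i * x k)‖ * ‖cexp (-(y i * x k))‖ := by
    rw [hw', norm_mul]
  have h1 : zlog3 y x θ' i k - y i * x k = Complex.log (1 + w) := by
    unfold zlog3
    rw [hw]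
    ring_nf
  rw [h1, ← hnw]
  exact Complex.norm_log_one_add_half_le_self (by rw [hnw]; exact hsmall)

/-- **`P̃ = ∑_{a,μ} P_{aμj}(θ') X₀^a W^μ ∈ ℂ[X₀, W₁, …, W_n]`**, the polynomial on `𝔾ₐ × 𝔾ₘⁿ`
attached to `(θ', j)`. [cite: Diaz1989, §II-3-4 p. 13 (the polynomial P̃)] -/
def Ptil (p : Unk n m D L b → ℤ) (θ' : Var n m → ℂ) (j : Var n m →₀ ℕ) :
    MvPolynomial (Fin (n + 1)) ℂ :=
  ∑ am : AM n D L, monomial (expW am) (coefPj p θ' j am)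

/-- The coefficient of `X₀^aW^μ` in `P̃` is `P_{aμj}(θ')`. [folklore] -/
theorem coeff_expW_Ptil (p : Unk n m D L b → ℤ) (θ' : Var n m → ℂ) (j : Var n m →₀ ℕ)
    (am : AM n D L) : coeff (expW am) (Ptil p θ' j) = coefPj p θ' j am := by
  classical
  unfold Ptil
  rw [MvPolynomial.coeff_sum, Finset.sum_eq_single am]
  · rw [MvPolynomial.coeff_monomial, if_pos rfl]
  · intro a' _ hne
    rw [MvPolynomial.coeff_monomial, if_neg fun h => hne (expW_injective h)]
  · intro h
    exact absurd (Finset.mem_univ am) h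

/-- **`P̃ ≠ 0`** when `j` is a minimal index at `θ'`. [cite: Diaz1989, §II-3-4 p. 13] -/
theorem Ptil_ne_zero {p : Unk n m D L b → ℤ} {θ' : Var n m → ℂ} {j : Var n m →₀ ℕ}
    (hj : IsMinIdx p θ' j) : Ptil p θ' j ≠ 0 := by
  obtain ⟨am, ham⟩ := hj.1
  intro h0
  apply ham
  have := coeff_expW_Ptil p θ' j am
  rw [h0, MvPolynomial.coeff_zero] at this
  exact this.symm

/-- The monomials of `P̃`. [folklore] -/
theorem eq_expW_of_mem_support_Ptil {p : Unk n m D L b → ℤ} {θ' : Var n m → ℂ}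
    {j : Var n m →₀ ℕ} {e : Fin (n + 1) →₀ ℕ} (he : e ∈ (Ptil p θ' j).support) :
    ∃ am : AM n D L, e = expW am := by
  rw [MvPolynomial.mem_support_iff] at he
  unfold Ptil at he
  rw [MvPolynomial.coeff_sum] at he
  obtain ⟨am, _, ham⟩ := Finset.exists_ne_zero_of_sum_ne_zero he
  rw [MvPolynomial.coeff_monomial] at ham
  exact ⟨am, by by_contra h; exact ham (if_neg (Ne.symm h))⟩

/-- `deg_{X₀} P̃ ≤ D - 1`. [folklore] -/
theorem degreeOf_Ptil_zero_le (p : Unk n m D L b → ℤ) (θ' : Var n m → ℂ) (j : Var n m →₀ ℕ) :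
    degreeOf 0 (Ptil p θ' j) ≤ D - 1 := by
  classical
  rw [degreeOf_le_iff]
  intro e he
  obtain ⟨am, rfl⟩ := eq_expW_of_mem_support_Ptil he
  have := am.1.isLt
  simp only [expW_zero]
  omega

/-- `deg_{W_h} P̃ ≤ L - 1`. [folklore] -/
theorem degreeOf_Ptil_succ_le (p : Unk n m D L b → ℤ) (θ' : Var n m → ℂ) (j : Var n m →₀ ℕ)
    (h : Fin n) : degreeOf h.succ (Ptil p θ' j) ≤ L - 1 := by
  classical
  rw [degreeOf_le_iff]
  intro e he
  obtain ⟨am, rfl⟩ := eq_expW_of_mem_support_Ptil he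
  have := (am.2 h).isLt
  simp only [expW_succ]
  omega

/-- **`P̃` on the translate of the one-parameter subgroup** (the identity behind the use of the
zero lemma): for all `τ`,
`P̃(σ(l) · exp_G(τ(1, ỹ))) = ∑ P_{aμj}(θ') E_{μ,l}(θ') (Y_l(θ') + τ)^a e^{W_μ(θ')τ}`, where
`σ(l) = exp_G(l·x̃, (∑_k l_kz_ik)_i)` and `e^{z_ik} = θ'(w_ik)`.
[cite: Diaz1989, §II-3-4 (13) p. 13 (here with the analytic direction (1, ỹ))] -/
theorem evalAt_Ptil_eq (y : Fin n → ℂ) (x : Fin m → ℂ) (p : Unk n m D L b → ℤ)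
    {θ' : Var n m → ℂ} (hne : ∀ i k, θ' (Sum.inr (Sum.inr (i, k))) ≠ 0) (j : Var n m →₀ ℕ)
    (l : Fin m → ℕ) (τ : ℂ) :
    evalAt (Ptil p θ' j) (sig (xtil θ') (zlog3 y x θ') (fun k => (l k : ℤ)) *
        GaGm.exp (τ • ((1 : ℂ), ytil θ'))) =
      ∑ am : AM n D L, coefPj p θ' j am * aeval θ' (Esym (natOf am.2) l) *
        ((aeval θ' (Ysym n l) + τ) ^ (am.1 : ℕ) * cexp (aeval θ' (Wsym m (natOf am.2)) * τ)) := by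
  classical
  rw [evalAt, coord_mul_exp_smul]
  unfold Ptil
  rw [map_sum]
  refine Finset.sum_congr rfl fun am _ => ?_
  rw [eval_monomial, Finsupp.prod_fintype _ _ (fun i => by simp), Fin.prod_univ_succ]
  simp only [Fin.cons_zero, Fin.cons_succ, expW_zero, expW_succ]
  -- the additive coordinate
  have h0 : Multiplicative.toAdd (sig (xtil θ') (zlog3 y x θ') (fun k => (l k : ℤ))).1 + τ * (1 : ℂ) =
      aeval θ' (Ysym n l) + τ := by
    rw [aeval_Ysym_eq, mul_one]
    congr 1
  -- the torus coordinates
  have h1 : ∀ i : Fin n, ((((sig (xtil θ') (zlog3 y x θ') (fun k => (l k : ℤ))).2 i : ℂˣ) : ℂ) *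
      cexp (τ * ytil θ' i)) = (∏ k, θ' (Sum.inr (Sum.inr (i, k))) ^ (l k)) * cexp (τ * ytil θ' i) := by
    intro i
    congr 1
    simp only [sig, GaGm.exp, wv, Units.val_mk0, Int.cast_natCast]
    rw [Complex.exp_sum]
    refine Finset.prod_congr rfl fun k _ => ?_
    rw [← exp_zlog3 y x i k (hne i k), ← Complex.exp_nat_mul]
  rw [h0]
  simp_rw [h1]
  rw [mul_assoc]
  congr 1
  rw [aeval_Wsym_eq, wfreq]
  -- `∏_i ((∏_k θ'_{ik}^{l_k}) e^{τỹ_i})^{μ_i} = E_{μ,l}(θ') e^{(∑ μ_iỹ_i) τ}`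
  have hE : aeval θ' (Esym (p := n) (q := m) (natOf am.2) l) =
      ∏ i, ∏ k, θ' (Sum.inr (Sum.inr (i, k))) ^ ((am.2 i : ℕ) * l k) := by
    simp [Esym, map_prod, natOf]
  rw [hE]
  have hexp : cexp ((∑ i, ((natOf am.2 i : ℕ) : ℂ) * ytil θ' i) * τ) =
      ∏ i, cexp (τ * ytil θ' i) ^ (am.2 i : ℕ) := by
    rw [Finset.sum_mul, Complex.exp_sum]
    refine Finset.prod_congr rfl fun i _ => ?_
    rw [← Complex.exp_nat_mul]
    congr 1
    simp only [natOf]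
    ring
  rw [hexp]
  have key : ∏ i, ((∏ k, θ' (Sum.inr (Sum.inr (i, k))) ^ l k) * cexp (τ * ytil θ' i)) ^ (am.2 i : ℕ) =
      (∏ i, ∏ k, θ' (Sum.inr (Sum.inr (i, k))) ^ ((am.2 i : ℕ) * l k)) *
        ∏ i, cexp (τ * ytil θ' i) ^ (am.2 i : ℕ) := by
    rw [← Finset.prod_mul_distrib]
    refine Finset.prod_congr rfl fun i _ => ?_
    rw [mul_pow, ← Finset.prod_pow]
    congr 1
    refine Finset.prod_congr rfl fun k _ => ?_
    rw [← pow_mul, mul_comm (l k)]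
  rw [key]
  ring

/-- **The vanishing of the family at `θ'` is the vanishing of `P̃` to high order along `(1, ỹ)`**:
`(d/dτ)^t P̃(σ(l)·exp_G(τ(1,ỹ)))|_{τ=0} = Q_{l,t,j}(θ')`. [folklore] -/
theorem iteratedDeriv_evalAt_Ptil (y : Fin n → ℂ) (x : Fin m → ℂ) (p : Unk n m D L b → ℤ)
    {θ' : Var n m → ℂ} (hne : ∀ i k, θ' (Sum.inr (Sum.inr (i, k))) ≠ 0) (j : Var n m →₀ ℕ)
    (l : Fin m → ℕ) (t : ℕ) :
    iteratedDeriv t (fun τ : ℂ => evalAt (Ptil p θ' j)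
      (sig (xtil θ') (zlog3 y x θ') (fun k => (l k : ℤ)) * GaGm.exp (τ • ((1 : ℂ), ytil θ')))) 0 =
      aeval θ' (Qj p l t j) := by
  rw [aeval_Qj_eq_iteratedDeriv]
  congr 1
  funext τ
  exact evalAt_Ptil_eq y x p hne j l τ

/-- **Zero-freeness at a point of the ball** (the contrapositive of the zero lemma with
multiplicities `DiazZLM.zeroLemmaMult_of_GaGm'`). For `n ≥ 1` there is `c = c(n) ∈ ℕ` such that:
if `j` is minimal at `θ'`, all `θ'(w_ik) ≠ 0`, the data `(y, ỹ, x, x̃, z = zlog3)` satisfy the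
closeness and size hypotheses of the zero lemma with `V, Δ`, the parameters satisfy
`cDLⁿ < (T+1)(B+1)^m`, `cLⁿ < (T+1)(B+1)^{m-1}`, and the measures of linear independence exclude
small `λ ∈ ℤⁿ`, `μ ∈ ℤ^m` (`|λ_h| ≤ L`, `|μ_k| ≤ LB²Δ`) with `|λ.y|·|μ.x| ≤ L²B²Δe^{-V}`, then some
member `Q_{l,t,j}`, `l ≤ (n+1)B`, `t ≤ (n+1)T`, does NOT vanish at `θ'`.
[cite: Diaz1989, §II-3-4 pp. 12–14 (the conclusion "𝓕 sans zéro commun dans la boule")] -/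
theorem exists_aeval_Qj_ne_zero (hZ : Philippon1986_GaGm) (n : ℕ) (hn : 1 ≤ n) :
    ∃ c : ℕ, ∀ (m : ℕ) (hm : 1 ≤ m) (D L b B T : ℕ) (p : Unk n m D L b → ℤ) (y : Fin n → ℂ)
      (x : Fin m → ℂ) (θ' : Var n m → ℂ) (j : Var n m →₀ ℕ) (V Δ : ℝ),
      1 ≤ B → 1 ≤ D → 1 ≤ L → Real.pi ≤ Δ →
      IsMinIdx p θ' j →
      (∀ i k, θ' (Sum.inr (Sum.inr (i, k))) ≠ 0) →
      (∑ i, ∑ k, ‖zlog3 y x θ' i k - y i * x k‖) ≤ Real.exp (-V) →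
      (∑ k, ‖xtil θ' k - x k‖) ≤ Real.exp (-V) →
      (∑ i, ‖ytil θ' i - y i‖) ≤ Real.exp (-V) →
      (∑ i, ∑ k, ‖zlog3 y x θ' i k‖) ≤ Δ → Real.pi * ‖y ⟨0, hn⟩‖ ≤ Δ →
      Real.pi * ‖x ⟨0, hm⟩‖ ≤ Δ →
      c * D * L ^ n < (T + 1) * (B + 1) ^ m →
      c * L ^ n < (T + 1) * (B + 1) ^ (m - 1) →
      (∀ (lam : Fin n → ℤ) (mu : Fin m → ℤ), lam ≠ 0 → mu ≠ 0 →
        (∀ h, |lam h| ≤ (L : ℤ)) → (∀ k, (|mu k| : ℝ) ≤ L * B ^ 2 * Δ) →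
        (L : ℝ) ^ 2 * B ^ 2 * Δ * Real.exp (-V) <
          ‖∑ h, (lam h : ℂ) * y h‖ * ‖∑ k, (mu k : ℂ) * x k‖) →
      ∃ (l : Fin m → ℕ) (t : ℕ), (∀ k, l k ≤ (n + 1) * B) ∧ t < (n + 1) * T + 1 ∧
        aeval θ' (Qj p l t j) ≠ 0 := by
  obtain ⟨c, hc⟩ := zeroLemmaMult_of_GaGm' hZ n hn
  refine ⟨c, ?_⟩
  intro m hm D L b B T p y x θ' j V Δ hB hD hL hΔ hj hne hz hx hy hzΔ hyΔ hxΔ hC1 hC2 hmeas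
  by_contra hall
  push Not at hall
  have hvan : ∀ μ : Fin m → ℕ, (∀ k, μ k ≤ (n + 1) * B) → ∀ s < (n + 1) * T + 1,
      iteratedDeriv s (fun τ : ℂ => evalAt (Ptil p θ' j)
        (sig (xtil θ') (zlog3 y x θ') (fun k => (μ k : ℤ)) * GaGm.exp (τ • ((1 : ℂ), ytil θ')))) 0 = 0 := by
    intro μ hμ s hs
    rw [iteratedDeriv_evalAt_Ptil y x p hne j μ s]
    exact hall μ s hμ hs
  obtain ⟨lam, mu, hlam, hmu, hlamL, hmuB, hprod⟩ :=
    hc m hm B T D L V Δ hB hD hL hΔ y (ytil θ') x (xtil θ') (zlog3 y x θ') hz hx hy hzΔ hyΔ hxΔ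
      (Ptil p θ' j) (Ptil_ne_zero hj)
      ((degreeOf_Ptil_zero_le p θ' j).trans (Nat.sub_le D 1))
      (fun h => (degreeOf_Ptil_succ_le p θ' j h).trans (Nat.sub_le L 1)) hvan hC1 hC2
  exact absurd hprod (not_le.mpr (hmeas lam mu hlam hmu hlamL hmuB))

end ZeroFree

end DiazMainIII

end Literature.NumberTheory.Transcendental

end
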